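import Summits.FinalStateConjecture.FinalStateConjecture.Theorems.ClusterCompletenessOmegaLimitMultiKerrSketchInnerHorizonMasqueradeAnchor
import Summits.FinalStateConjecture.FinalStateConjecture.Theorems.ClusterCompletenessOmegaLimitMultiKerrSketchInnerHorizonMasqueradeHorizon
import HarnessLib

/-!
# Crux `ClusterCompleteness.OmegaLimitMultiKerr` (stmt-FinalStateConjecture-17639), line `Sketch` v8 —
# the INNER-HORIZON MASQUERADE, part 4: no gauge onto a Kerr exterior; the REPAIRED no-hair text is false

Part 4 of the wave-4 audit witness (parts 1–3: `…SketchInnerHorizonMasquerade`, `…MasqueradeHorizon`,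
`…MasqueradeAnchor`). Two results.

* `squeezed_no_gauge`: for `0 < ν < 1` and `G = B^* g_{M₁,1}` (`M₁ = (1+ν²)/(2ν)`, `B = diag(1,1,1,ν)`) on
  `Ext = {r_ν > 1}`, there is NO `(M', a', Λ', c', θ, κ)` with `0 < M'`, `Λ'e₀ = e₀`, `θ` differentiable on
  `Ext' = boostedKerrExterior Λ' c' M' a'`, `θ(x + s e₀) = θ(x) + κ s e₀`, `θ '' Ext' = Ext` and
  `G(θx)(dθ v, dθ w) = g_{M',a',Λ',c'}(x)(v, w)`. Differentiating the rate clause gives `dθ(e₀) = κ e₀`, so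
  the isometry clause at `(e₀, e₀)` reads `κ²(−1 + 2H₁(Bθx)) = −1 + 2H'(Λ'⁻¹(x − c'))`. Far out in `Ext'`
  (`H' ≤ M'/r' → 0`, `H₁ ≥ 0`) this forces `κ² ≥ 1`; far out in `Ext` (`H₁ ≤ M₁/r_1 → 0`, `H' ≥ 0`, ontoness)
  `κ² ≤ 1`; so `H₁(By) = H'(θ⁻¹y) < M'/r₊' ≤ 1` for all `y ∈ Ext`, contradicted at the equatorial point
  `y* = (0, √(r*² + 1), 0, 0)`, `r* = (ν + M₁)/2`, where `By* = y*`, `r_1(y*) = r* < M₁`, `r_ν(y*) > 1` and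
  `H₁(y*) = M₁/r* > 1` (the region `B⁻¹{ν < r_1 < 1/ν}` between the horizons of `g_{M₁,1}` lies inside `Ext`).
* `stub_noHairUpToGauge_v8b_false`: the v8 text of `stub_noHairUpToGauge` with its `θ`-jet clause repaired to
  start at order `1` (`‖iteratedFDeriv ℝ (j+1) θ x‖ ≤ C`, cf. `…SketchNoHairV8Refutation`) is STILL FALSE: at
  `k = 0`, `Λ = 1`, `c = 0`, `(M, a) = ((1+ν²)/2, ν)` (closed label, `r₊ = 1`) with
  `1 − ν = 2⁻²³/(C₁ + 1)`, the squeezed form `G` is smooth, Lorentzian, Ricci-flat, `1/32`-anchored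
  (`squeezed_anchor`), tame at all orders (`squeezed_tame`), stationary, with null inner boundary
  (`squeezed_null_boundary`), and admits no gauge. Missing hypothesis: "no horizon of `G` inside `Ext`", e.g.
  `0 < dr(G⁻¹dr)` on `Ext` (for the witness `G^{rr} < 0` on `B⁻¹{ν < r_1 < 1/ν}`).
-/

set_option linter.dupNamespace false
set_option maxSynthPendingDepth 3

noncomputable section

open scoped Topology Manifold ContDiff
open Filter Set Function TopologicalSpace Literature.Geometry.Lorentzian
open Summit.FinalStateConjecture.FinalStateConjecture.Theorems.SublinearIsFree.Rechart
  (norm_iteratedFDeriv_clm_postcomp_le)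

namespace Summit.FinalStateConjecture.FinalStateConjecture.Theorems.ClusterCompleteness

/-! ### Points of the exteriors -/
/-- Components of the point `(0, R, 0, 0)`. [folklore] -/
theorem ofTimeSpace_single_apply (R : ℝ) :
    E4.ofTimeSpace 0 (R • EuclideanSpace.single (0 : Fin 3) (1 : ℝ)) 0 = 0 ∧
    E4.ofTimeSpace 0 (R • EuclideanSpace.single (0 : Fin 3) (1 : ℝ)) 1 = R ∧
    E4.ofTimeSpace 0 (R • EuclideanSpace.single (0 : Fin 3) (1 : ℝ)) 2 = 0 ∧
    E4.ofTimeSpace 0 (R • EuclideanSpace.single (0 : Fin 3) (1 : ℝ)) 3 = 0 := by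
  refine ⟨rfl, ?_, ?_, ?_⟩
  · rw [show (1 : Fin 4) = (0 : Fin 3).succ from rfl, E4.ofTimeSpace_apply_succ]
    simp
  · rw [show (2 : Fin 4) = (1 : Fin 3).succ from rfl, E4.ofTimeSpace_apply_succ]
    simp
  · rw [show (3 : Fin 4) = (2 : Fin 3).succ from rfl, E4.ofTimeSpace_apply_succ]
    simp

/-- **Far points of a boosted Kerr exterior**: for every `K` there is `x ∈ boostedKerrExterior Λ' c' M' a'`
with rest-frame radius `> K` (`0 < M'`). [folklore] -/
theorem exists_far_mem_boostedKerrExterior (Λ' : lorentzGroup) (c' : E4) {M' : ℝ} (hM' : 0 < M') (a' K : ℝ) :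
    ∃ x ∈ (boostedKerrExterior Λ' c' M' a' : Set E4), K < Kerr.radius a' (poincareInv Λ' c' x) := by
  obtain ⟨K₁, hK₁⟩ : ∃ K₁ : ℝ, K₁ = |K| + 2 * M' + 1 := ⟨_, rfl⟩
  have hK₁0 : 0 < K₁ := by rw [hK₁]; positivity
  obtain ⟨R, hR⟩ : ∃ R : ℝ, R = K₁ + |a'| + 1 := ⟨_, rfl⟩
  have hRpos : 0 < R := by rw [hR]; positivity
  set y₀ : E4 := E4.ofTimeSpace 0 (R • EuclideanSpace.single (0 : Fin 3) (1 : ℝ)) with hy₀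
  have hy₀n : E4.spatialNorm y₀ = R := by
    rw [hy₀, E4.spatialNorm_ofTimeSpace, norm_smul, PiLp.norm_single, norm_one, mul_one,
      Real.norm_eq_abs, abs_of_pos hRpos]
  have hrad : K₁ < Kerr.radius a' y₀ := by
    have h1 := Kerr.spatialNorm_sq_sub_sq_le_radius_sq a' y₀
    rw [hy₀n] at h1
    have h2 : K₁ ^ 2 < R ^ 2 - a' ^ 2 := by
      rw [hR]
      nlinarith [abs_nonneg a', sq_abs a']
    nlinarith [Kerr.radius_nonneg a' y₀]
  refine ⟨(Λ' : E4 ≃L[ℝ] E4) y₀ + c', ?_, ?_⟩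
  · have hp : poincareInv Λ' c' ((Λ' : E4 ≃L[ℝ] E4) y₀ + c') = y₀ := by
      rw [poincareInv, add_sub_cancel_right, ContinuousLinearEquiv.symm_apply_apply]
    rw [SetLike.mem_coe, mem_boostedKerrExterior, hp, Kerr.mem_exterior]
    refine max_lt ?_ (hK₁0.trans hrad)
    have hrp : Kerr.rPlus M' a' ≤ 2 * M' := by
      unfold Kerr.rPlus
      have h1 : √(M' ^ 2 - a' ^ 2) ≤ √(M' ^ 2) := Real.sqrt_le_sqrt (by nlinarith [sq_nonneg a'])
      rw [Real.sqrt_sq hM'.le] at h1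
      linarith
    calc Kerr.rPlus M' a' ≤ 2 * M' := hrp
      _ < K₁ := by rw [hK₁]; linarith [abs_nonneg K]
      _ < Kerr.radius a' y₀ := hrad
  · rw [poincareInv, add_sub_cancel_right, ContinuousLinearEquiv.symm_apply_apply]
    calc K ≤ |K| := le_abs_self K
      _ < K₁ := by rw [hK₁]; linarith
      _ < Kerr.radius a' y₀ := hrad

/-- **Far equatorial points of `{r_ν > 1}`**: for every `K` there is `y` with `y³ = 0`, `r_ν(y) > 1` and
`r_1(y) > K` (`0 < ν ≤ 1`). [folklore] -/
theorem exists_far_equatorial {ν : ℝ} (hν0 : 0 < ν) (hν1 : ν ≤ 1) (K : ℝ) :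
    ∃ y : E4, y 3 = 0 ∧ 1 < Kerr.radius ν y ∧ K < Kerr.radius 1 y := by
  set R : ℝ := |K| + 2 with hR
  obtain ⟨h0, h1, h2, h3⟩ := ofTimeSpace_single_apply R
  refine ⟨E4.ofTimeSpace 0 (R • EuclideanSpace.single (0 : Fin 3) (1 : ℝ)), h3, ?_, ?_⟩
  · rw [lt_radius_iff_spheroid ν one_pos, h1, h2, h3, hR]
    nlinarith [abs_nonneg K]
  · have hK : K < |K| + 1 := by linarith [le_abs_self K]
    refine hK.trans ?_
    rw [lt_radius_iff_spheroid 1 (by positivity), h1, h2, h3, hR]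
    nlinarith [abs_nonneg K, sq_nonneg (|K| + 1)]

/-- **The witness point between the horizons**: for `0 < ν < 1`, `M₁ = (1+ν²)/(2ν)`, there is an equatorial
`y` (`y³ = 0`) with `r_ν(y) > 1` and `H_{M₁,1}(y) > 1` (namely `r_1(y) = r* = (ν + M₁)/2 ∈ (ν, M₁)`,
`H = M₁/r*`). [folklore] -/
theorem exists_equatorial_large_scalarH {ν : ℝ} (hν0 : 0 < ν) (hν1 : ν < 1) :
    ∃ y : E4, y 3 = 0 ∧ 1 < Kerr.radius ν y ∧ 1 < Kerr.scalarH ((1 + ν ^ 2) / (2 * ν)) 1 y := by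
  set M₁ : ℝ := (1 + ν ^ 2) / (2 * ν) with hM₁
  have hνM : ν < M₁ := lt_label₁ hν0 hν1
  set rs : ℝ := (ν + M₁) / 2 with hrs
  have hrs0 : 0 < rs := by rw [hrs]; linarith
  have hrs1 : ν < rs := by rw [hrs]; linarith
  have hrs2 : rs < M₁ := by rw [hrs]; linarith
  set R : ℝ := √(rs ^ 2 + 1) with hR
  have hR2 : R ^ 2 = rs ^ 2 + 1 := Real.sq_sqrt (by positivity)
  obtain ⟨h0, h1, h2, h3⟩ := ofTimeSpace_single_apply R
  set y := E4.ofTimeSpace 0 (R • EuclideanSpace.single (0 : Fin 3) (1 : ℝ)) with hy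
  have hr1 : Kerr.radius 1 y = rs := by
    rw [radius_eq_iff_spheroid 1 hrs0, h1, h2, h3]
    nlinarith
  refine ⟨y, h3, ?_, ?_⟩
  · rw [lt_radius_iff_spheroid ν one_pos, h1, h2, h3]
    nlinarith
  · rw [Kerr.scalarH_of_apply_three_eq_zero M₁ h3 (by rw [hr1]; exact hrs0), hr1, lt_div_iff₀ hrs0]
    linarith

/-! ### No gauge onto a Kerr exterior -/

section NoGauge

variable {ν : ℝ} {B : E4 →L[ℝ] E4}
  (hB : ∀ w : E4, B w = w + ((ν - 1) * w 3) • E4.basisVector 3)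
  {G : E4 → E4 →L[ℝ] E4 →L[ℝ] ℝ}
  (hG : ∀ y v w, G y v w = Kerr.bilin ((1 + ν ^ 2) / (2 * ν)) 1 (B y) (B v) (B w))

include hB hG in
/-- **No gauge onto the squeezed form.** See the module docstring: the isometry clause at `(e₀, e₀)` reads
`κ²(−1 + 2H₁(Bθx)) = −1 + 2H'`, far points of the two exteriors force `κ² = 1`, and then
`H₁ < 1` on `B(Ext)` contradicts the equatorial point between the horizons where `H₁ = M₁/r* > 1`.
[folklore] -/
theorem squeezed_no_gauge (hν0 : 0 < ν) (hν1 : ν < 1) {M' a' κ : ℝ} {Λ' : lorentzGroup} {c' : E4}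
    {θ : E4 → E4} (hM' : 0 < M') (hΛ' : (Λ' : E4 ≃L[ℝ] E4) (E4.basisVector 0) = E4.basisVector 0)
    (hθ : DifferentiableOn ℝ θ (boostedKerrExterior Λ' c' M' a' : Set E4))
    (hcomm : ∀ x ∈ (boostedKerrExterior Λ' c' M' a' : Set E4), ∀ s : ℝ,
      θ (x + s • E4.basisVector 0) = θ x + (κ * s) • E4.basisVector 0)
    (himage : θ '' (boostedKerrExterior Λ' c' M' a' : Set E4) =
      (boostedKerrExterior 1 0 ((1 + ν ^ 2) / 2) ν : Set E4))
    (hiso : ∀ x ∈ (boostedKerrExterior Λ' c' M' a' : Set E4), ∀ v w : E4,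
      G (θ x) (fderiv ℝ θ x v) (fderiv ℝ θ x w) = boostedKerrBilin Λ' c' M' a' x v w) : False := by
  set M₁ : ℝ := (1 + ν ^ 2) / (2 * ν) with hM₁
  have hM₁0 : 0 ≤ M₁ := by positivity
  have hΛ's : (Λ' : E4 ≃L[ℝ] E4).symm (E4.basisVector 0) = E4.basisVector 0 := by
    rw [ContinuousLinearEquiv.symm_apply_eq]
    exact hΛ'.symm
  have hopen : IsOpen (boostedKerrExterior Λ' c' M' a' : Set E4) := (boostedKerrExterior Λ' c' M' a').isOpen
  -- the isometry clause at `(e₀, e₀)`: `κ² (−1 + 2H₁(Bθx)) = −1 + 2H'`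
  have hkey : ∀ x ∈ (boostedKerrExterior Λ' c' M' a' : Set E4),
      κ ^ 2 * (-1 + 2 * Kerr.scalarH M₁ 1 (B (θ x))) = -1 + 2 * Kerr.scalarH M' a' (poincareInv Λ' c' x) := by
    intro x hx
    have hdiff : DifferentiableAt ℝ θ x := (hθ x hx).differentiableAt (hopen.mem_nhds hx)
    have hline : ∀ p : E4, HasDerivAt (fun t : ℝ ↦ p + (κ * t) • E4.basisVector 0) (κ • E4.basisVector 0) 0 :=
      fun p ↦ by
        have h := (((hasDerivAt_id (0 : ℝ)).const_mul κ).smul_const (E4.basisVector 0)).const_add p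
        simpa using h
    have hline1 : ∀ p : E4, HasDerivAt (fun t : ℝ ↦ p + t • E4.basisVector 0) (E4.basisVector 0) 0 :=
      fun p ↦ by simpa using ((hasDerivAt_id (0 : ℝ)).smul_const (E4.basisVector 0)).const_add p
    have hdθ : fderiv ℝ θ x (E4.basisVector 0) = κ • E4.basisVector 0 := by
      have hc1 : HasDerivAt (fun t : ℝ ↦ θ (x + t • E4.basisVector 0)) (fderiv ℝ θ x (E4.basisVector 0)) 0 := by
        have hf : HasFDerivAt θ (fderiv ℝ θ x) (x + (0 : ℝ) • E4.basisVector 0) := by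
          rw [zero_smul, add_zero]
          exact hdiff.hasFDerivAt
        exact hf.comp_hasDerivAt (0 : ℝ) (hline1 x)
      have hc2 : HasDerivAt (fun t : ℝ ↦ θ (x + t • E4.basisVector 0)) (κ • E4.basisVector 0) 0 := by
        have : (fun t : ℝ ↦ θ (x + t • E4.basisVector 0)) = fun t ↦ θ x + (κ * t) • E4.basisVector 0 :=
          funext fun t ↦ hcomm x hx t
        rw [this]
        exact hline (θ x)
      exact hc1.unique hc2
    have h := hiso x hx (E4.basisVector 0) (E4.basisVector 0)
    rw [hdθ] at h
    simp only [map_smul, smul_apply, smul_eq_mul] at h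
    rw [squeezed_basisVector_zero hB hG, boostedKerrBilin_apply, hΛ's, kerr_bilin_basisVector_zero] at h
    rw [← h]
    ring
  -- (1) `κ² ≥ 1` from far points of `Ext'`
  have hκ1 : 1 ≤ κ ^ 2 := by
    by_contra hlt
    rw [not_le] at hlt
    obtain ⟨x, hx, hfar⟩ := exists_far_mem_boostedKerrExterior Λ' c' hM' a' (4 * M' / (1 - κ ^ 2))
    have hr0 : 0 < Kerr.radius a' (poincareInv Λ' c' x) := lt_trans (by positivity) hfar
    have h := hkey x hx
    have hH1 : 0 ≤ Kerr.scalarH M₁ 1 (B (θ x)) := Kerr.scalarH_nonneg hM₁0 1 _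
    have hH' := Kerr.scalarH_le_div hM'.le a' hr0
    have h1 : -κ ^ 2 ≤ -1 + 2 * (M' / Kerr.radius a' (poincareInv Λ' c' x)) := by nlinarith [sq_nonneg κ]
    have h2 : M' / Kerr.radius a' (poincareInv Λ' c' x) < (1 - κ ^ 2) / 4 := by
      rw [div_lt_iff₀ hr0]
      have := (div_lt_iff₀ (by linarith : (0 : ℝ) < 1 - κ ^ 2)).1 hfar
      nlinarith
    linarith
  -- (2) `κ² ≤ 1` from far points of `Ext` (ontoness)
  have hκ2 : κ ^ 2 ≤ 1 := by
    by_contra hlt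
    rw [not_le] at hlt
    obtain ⟨y, hy3, hy1, hfar⟩ := exists_far_equatorial hν0 hν1.le (4 * κ ^ 2 * M₁ / (κ ^ 2 - 1))
    have hyExt : y ∈ (boostedKerrExterior 1 0 ((1 + ν ^ 2) / 2) ν : Set E4) :=
      (mem_exterior_label_iff hν0 hν1 y).2 hy1
    rw [← himage] at hyExt
    obtain ⟨x, hx, rfl⟩ := hyExt
    have hBy : B (θ x) = θ x := by rw [hB, hy3, mul_zero, zero_smul, add_zero]
    have hr0 : 0 < Kerr.radius 1 (θ x) := lt_trans (by positivity) hfar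
    have h := hkey x hx
    rw [hBy] at h
    have hH' : 0 ≤ Kerr.scalarH M' a' (poincareInv Λ' c' x) := Kerr.scalarH_nonneg hM'.le a' _
    have hH1 := Kerr.scalarH_le_div hM₁0 1 hr0
    have h1 : κ ^ 2 * (1 - 2 * (M₁ / Kerr.radius 1 (θ x))) ≤ 1 := by nlinarith [sq_nonneg κ]
    have h2 : κ ^ 2 * (M₁ / Kerr.radius 1 (θ x)) < (κ ^ 2 - 1) / 4 := by
      rw [← mul_div_assoc, div_lt_iff₀ hr0]
      have := (div_lt_iff₀ (by linarith : (0 : ℝ) < κ ^ 2 - 1)).1 hfar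
      nlinarith
    nlinarith
  have hκ : κ ^ 2 = 1 := le_antisymm hκ2 hκ1
  -- (3) the point between the horizons
  obtain ⟨y, hy3, hy1, hH⟩ := exists_equatorial_large_scalarH hν0 hν1
  have hyExt : y ∈ (boostedKerrExterior 1 0 ((1 + ν ^ 2) / 2) ν : Set E4) :=
    (mem_exterior_label_iff hν0 hν1 y).2 hy1
  rw [← himage] at hyExt
  obtain ⟨x, hx, rfl⟩ := hyExt
  have hBy : B (θ x) = θ x := by rw [hB, hy3, mul_zero, zero_smul, add_zero]
  have h := hkey x hx
  rw [hBy, hκ, one_mul] at h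
  -- `H' < 1` on the exterior: `H' ≤ M'/r' < M'/r₊' ≤ 1`
  have hxr : Kerr.rPlus M' a' < Kerr.radius a' (poincareInv Λ' c' x) := by
    have hx' := hx
    rw [SetLike.mem_coe, mem_boostedKerrExterior, Kerr.mem_exterior] at hx'
    exact (le_max_left _ _).trans_lt hx'
  have hrp : M' ≤ Kerr.rPlus M' a' := by
    unfold Kerr.rPlus
    linarith [Real.sqrt_nonneg (M' ^ 2 - a' ^ 2)]
  have hr0 : 0 < Kerr.radius a' (poincareInv Λ' c' x) := hM'.trans_le (hrp.trans hxr.le)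
  have hH' := Kerr.scalarH_le_div hM'.le a' hr0
  have hlt : M' / Kerr.radius a' (poincareInv Λ' c' x) < 1 := by
    rw [div_lt_one hr0]
    exact hrp.trans_lt hxr
  linarith

end NoGauge

/-! ### Tame bounds of the squeezed form -/
section Tame

variable {ν : ℝ} {B : E4 →L[ℝ] E4}
  (hB : ∀ w : E4, B w = w + ((ν - 1) * w 3) • E4.basisVector 3)

include hB in
/-- **All-order tame bounds of `y ↦ L(g_{M₁,1}(By))` on `{r_ν > 1}`** (`0 < ν ≤ 1`, any operator `L`):
`‖Dʲ(f ∘ B)‖ ≤ ‖Dʲf‖ ‖B‖ʲ ≤ ‖Dʲf‖` (`‖B‖ ≤ 1`) and `exists_bound_iteratedFDeriv_kerr_bilin` on `{r_1 ≥ ν}`.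
[folklore] -/
theorem squeezed_tame (hν0 : 0 < ν) (hν1 : ν ≤ 1)
    (L : (E4 →L[ℝ] E4 →L[ℝ] ℝ) →L[ℝ] (E4 →L[ℝ] E4 →L[ℝ] ℝ)) (M₁ : ℝ) (j : ℕ) :
    ∃ C : ℝ, ∀ x : E4, 1 < Kerr.radius ν x →
      ‖iteratedFDeriv ℝ j (fun y ↦ L (Kerr.bilin M₁ 1 (B y))) x‖ ≤ C := by
  obtain ⟨C, hC⟩ := exists_bound_iteratedFDeriv_kerr_bilin M₁ 1 hν0 j
  refine ⟨‖L‖ * |C|, fun x hx ↦ ?_⟩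
  set s : Set E4 := (Kerr.region 1 0 : Set E4) with hs_def
  have hs : IsOpen s := (Kerr.region 1 0).isOpen
  have hV : IsOpen (B ⁻¹' s) := hs.preimage B.continuous
  have hBx : ν < Kerr.radius 1 (B x) := (nu_lt_radius_squeeze_iff hB hν0 x).2 hx
  have hBxs : B x ∈ s := by
    rw [hs_def, SetLike.mem_coe, Kerr.mem_region, max_self]
    exact hν0.trans hBx
  have hxV : x ∈ B ⁻¹' s := hBxs
  have hf : ContDiffOn ℝ ∞ (Kerr.bilin M₁ 1) s := fun y hy ↦
    (Kerr.contDiffAt_bilin M₁ 1 (Kerr.radius_pos_of_mem_region hy)).contDiffWithinAt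
  have hfB : ContDiffOn ℝ ∞ (Kerr.bilin M₁ 1 ∘ B) (B ⁻¹' s) := hf.comp B.contDiff.contDiffOn fun _ h ↦ h
  have h1 := norm_iteratedFDeriv_clm_postcomp_le L le_rfl hV hxV hfB j
  have hB1 : ‖B‖ ≤ 1 := B.opNorm_le_bound zero_le_one fun w ↦ by
    rw [one_mul]
    exact norm_squeeze_le hB (by nlinarith) w
  have h2 : ‖iteratedFDeriv ℝ j (Kerr.bilin M₁ 1 ∘ B) x‖ ≤ ‖iteratedFDeriv ℝ j (Kerr.bilin M₁ 1) (B x)‖ := by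
    rw [← iteratedFDerivWithin_of_isOpen j hV hxV, B.iteratedFDerivWithin_comp_right hf hs.uniqueDiffOn
      hV.uniqueDiffOn hBxs (i := j) (by exact_mod_cast le_top), iteratedFDerivWithin_of_isOpen j hs hBxs]
    refine (ContinuousMultilinearMap.norm_compContinuousLinearMap_le _ _).trans ?_
    have hprod : ∏ _i : Fin j, ‖B‖ ≤ 1 := Finset.prod_le_one (fun _ _ ↦ norm_nonneg _) fun _ _ ↦ hB1
    calc ‖iteratedFDeriv ℝ j (Kerr.bilin M₁ 1) (B x)‖ * ∏ _i : Fin j, ‖B‖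
        ≤ ‖iteratedFDeriv ℝ j (Kerr.bilin M₁ 1) (B x)‖ * 1 := mul_le_mul_of_nonneg_left hprod (norm_nonneg _)
      _ = _ := mul_one _
  calc ‖iteratedFDeriv ℝ j (fun y ↦ L (Kerr.bilin M₁ 1 (B y))) x‖
      ≤ ‖L‖ * ‖iteratedFDeriv ℝ j (Kerr.bilin M₁ 1 ∘ B) x‖ := h1
    _ ≤ ‖L‖ * |C| :=
        mul_le_mul_of_nonneg_left (h2.trans ((hC (B x) hBx.le).trans (le_abs_self C))) (norm_nonneg _)

end Tame

/-! ### The refutation of the repaired text -/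

set_option synthInstance.maxHeartbeats 200000 in
set_option maxHeartbeats 800000 in
/-- **The repaired no-hair text (θ-jets from order `1`) is false: the inner-horizon masquerade.** At `k = 0`,
`Λ = 1`, `c = 0`, `(M, a) = ((1+ν²)/2, ν)` with `1 − ν = 2⁻²³/(C₁+1)` (`C₁` a bound of `‖D(g_{1,1} − η)‖` on
`{r_1 ≥ 1/4}`), the squeezed form `G(y)(v,w) = g_{M₁,1}(By)(Bv,Bw)`, `B = diag(1,1,1,ν)`, `M₁ = (1+ν²)/(2ν)`,
meets all seven hypotheses and admits no gauge (`squeezed_no_gauge`). [folklore] -/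
theorem stub_noHairUpToGauge_v8b_false : ¬ (∀ k : ℕ, ∀ (Λ : lorentzGroup) (c : E4) (M a : ℝ), 0 < M → |a| ≤ M → ∀ (G : E4 → E4 →L[ℝ] E4 →L[ℝ] ℝ), ContDiffOn ℝ ∞ G (boostedKerrExterior Λ c M a : Set E4) → (∀ x ∈ (boostedKerrExterior Λ c M a : Set E4), (G x).IsInvertible ∧ (∀ v w : E4, G x v w = G x w v) ∧ ∃ v : E4, G x v v < 0 ∧ ∀ w : E4, G x v w = 0 → w ≠ 0 → 0 < G x w w) → (∀ x ∈ (boostedKerrExterior Λ c M a : Set E4), MetricCoord.ricAt G x = 0) → (∀ x ∈ (boostedKerrExterior Λ c M a : Set E4), ‖G x - boostedKerrBilin Λ c M a x‖ ≤ 1 / 32) → (∀ (j : ℕ) (R' : ℝ), ∃ C : ℝ, ∀ x ∈ (boostedKerrExterior Λ c M a : Set E4), Kerr.radius a (poincareInv Λ c x) ≤ R' → ‖iteratedFDeriv ℝ j G x‖ ≤ C) → (∀ x ∈ (boostedKerrExterior Λ c M a : Set E4), ∀ s : ℝ, G (x + s • ((Λ : E4 ≃L[ℝ] E4) (E4.basisVector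 0))) = G x) → (∀ ε : ℝ, 0 < ε → ∃ δ : ℝ, 0 < δ ∧ ∀ x ∈ (boostedKerrExterior Λ c M a : Set E4), Kerr.radius a (poincareInv Λ c x) < Kerr.rPlus M a + δ → |((fderiv ℝ (fun y ↦ Kerr.radius a (poincareInv Λ c y)) x) (MetricCoord.sharpAt G x (fderiv ℝ (fun y ↦ Kerr.radius a (poincareInv Λ c y)) x)))| ≤ ε) → ∃ (M' a' : ℝ) (Λ' : lorentzGroup) (c' : E4) (θ : E4 → E4) (κ : ℝ), 0 < M' ∧ |a'| ≤ M' ∧ 0 < κ ∧ (Λ' : E4 ≃L[ℝ] E4) (E4.basisVector 0) = ((Λ : E4 ≃L[ℝ] E4) (E4.basisVector 0)) ∧ ContDiffOn ℝ ∞ θ (boostedKerrExterior Λ' c' M' a' : Set E4) ∧ Set.InjOn θ (boostedKerrExterior Λ' c' M' a' : Set E4) ∧ θ '' (boostedKerrExterior Λ' c' M' a' : Set E4) = (boostedKerrExterior Λ c M a : Set E4) ∧ (∀ x ∈ (boostedKerrExterior Λ' c' M' a' : Set E4), ∀ s : ℝ, θ (x + s • ((Λ : E4 ≃L[ℝ]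 E4) (E4.basisVector 0))) = θ x + (κ * s) • ((Λ : E4 ≃L[ℝ] E4) (E4.basisVector 0))) ∧ (∀ x ∈ (boostedKerrExterior Λ' c' M' a' : Set E4), ‖fderiv ℝ θ x‖ ≤ 2) ∧ (∀ (j : ℕ) (R' : ℝ), ∃ C : ℝ, ∀ x ∈ (boostedKerrExterior Λ' c' M' a' : Set E4), Kerr.radius a' (poincareInv Λ' c' x) ≤ R' → ‖iteratedFDeriv ℝ (j + 1) θ x‖ ≤ C) ∧ ∀ x ∈ (boostedKerrExterior Λ' c' M' a' : Set E4), ∀ v w : E4, G (θ x) (fderiv ℝ θ x v) (fderiv ℝ θ x w) = boostedKerrBilin Λ' c' M' a' x v w ∧ ((∃ κ₀ δ : ℝ, 0 < κ₀ ∧ 0 < δ ∧ ∀ x ∈ (boostedKerrExterior Λ c M a : Set E4), Kerr.radius a (poincareInv Λ c x) < Kerr.rPlus M a + δ → κ₀ * (Kerr.radius a (poincareInv Λ c x) - Kerr.rPlus M a) ≤ (fderiv ℝ (fun y ↦ Kerr.radius a (poincareInv Λ c y)) x) (MetricCoord.sharpAt G x (fderiv ℝ (fun y ↦ Kerr.radius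 a (poincareInv Λ c y)) x))) → Kerr.IsSubextremal M' a')) := by
  intro h
  -- (0) the parameter `ν`
  obtain ⟨C₁, hC0, hC₁⟩ := exists_bound_fderiv_ksPert_one_one
  set ε : ℝ := 1 / (8388608 * (C₁ + 1)) with hε
  have hε0 : 0 < ε := by positivity
  have hεle : ε ≤ 1 / 8388608 := by
    rw [hε]
    exact div_le_div_of_nonneg_left zero_le_one (by norm_num) (by nlinarith)
  set ν : ℝ := 1 - ε with hν_def
  have hν0 : 0 < ν := by rw [hν_def]; linarith
  have hν1 : ν < 1 := by rw [hν_def]; linarith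
  have hν : ν ≠ 0 := hν0.ne'
  have hνlo : 1 - 1 / (8388608 * (C₁ + 1)) ≤ ν := le_rfl
  set M₁ : ℝ := (1 + ν ^ 2) / (2 * ν) with hM₁
  have hM₁0 : 0 ≤ M₁ := by positivity
  -- (1) the maps `B = diag(1,1,1,ν)`, `B' = B⁻¹`, the post-composition `L`, and `G`
  set B : E4 →L[ℝ] E4 :=
    ContinuousLinearMap.id ℝ E4 + (ν - 1) • (E4.dx 3).smulRight (E4.basisVector 3) with hB_def
  set B' : E4 →L[ℝ] E4 :=
    ContinuousLinearMap.id ℝ E4 + (ν⁻¹ - 1) • (E4.dx 3).smulRight (E4.basisVector 3) with hB'_def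
  have hB : ∀ w : E4, B w = w + ((ν - 1) * w 3) • E4.basisVector 3 := fun w ↦ by
    simp only [hB_def, add_apply, ContinuousLinearMap.id_apply,
      FunLike.coe_smul, Pi.smul_apply, ContinuousLinearMap.smulRight_apply, smul_smul]
    rfl
  have hB' : ∀ w : E4, B' w = w + ((ν⁻¹ - 1) * w 3) • E4.basisVector 3 := fun w ↦ by
    simp only [hB'_def, add_apply, ContinuousLinearMap.id_apply,
      FunLike.coe_smul, Pi.smul_apply, ContinuousLinearMap.smulRight_apply, smul_smul]
    rfl
  set L : (E4 →L[ℝ] E4 →L[ℝ] ℝ) →L[ℝ] (E4 →L[ℝ] E4 →L[ℝ] ℝ) :=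
    ((ContinuousLinearMap.compL ℝ E4 (E4 →L[ℝ] ℝ) (E4 →L[ℝ] ℝ))
      (ContinuousLinearMap.precomp ℝ B)).comp (ContinuousLinearMap.precomp (E4 →L[ℝ] ℝ) B) with hL_def
  set G : E4 → E4 →L[ℝ] E4 →L[ℝ] ℝ := fun y ↦ L (Kerr.bilin M₁ 1 (B y)) with hG_def
  have hG : ∀ y v w, G y v w = Kerr.bilin ((1 + ν ^ 2) / (2 * ν)) 1 (B y) (B v) (B w) := fun y v w ↦ rfl
  -- (2) the exterior `{r_ν > 1}` and the unit time axis
  have h1e : ((1 : lorentzGroup) : E4 ≃L[ℝ] E4) (E4.basisVector 0) = E4.basisVector 0 := rfl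
  have hExt : ∀ x : E4, x ∈ (boostedKerrExterior 1 0 ((1 + ν ^ 2) / 2) ν : Set E4) ↔ 1 < Kerr.radius ν x :=
    mem_exterior_label_iff hν0 hν1
  have hfun : (fun y ↦ Kerr.radius ν (poincareInv 1 0 y)) = Kerr.radius ν :=
    funext fun y ↦ by rw [poincareInv_one_zero]
  have hBpos : ∀ x : E4, 1 < Kerr.radius ν x → 0 < Kerr.radius 1 (B x) := fun x hx ↦
    hν0.trans ((nu_lt_radius_squeeze_iff hB hν0 x).2 hx)
  have hsmooth : ∀ x : E4, 0 < Kerr.radius 1 (B x) → ContDiffAt ℝ ∞ G x := fun x hx ↦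
    L.contDiff.contDiffAt.comp x ((Kerr.contDiffAt_bilin M₁ 1 hx).comp x B.contDiff.contDiffAt)
  have hGc : ContDiffOn ℝ ∞ G (B ⁻¹' (Kerr.region 1 0 : Set E4)) := fun x hx ↦ by
    refine (hsmooth x ?_).contDiffWithinAt
    have hx' : B x ∈ (Kerr.region 1 0 : Set E4) := hx
    rw [SetLike.mem_coe, Kerr.mem_region, max_self] at hx'
    exact hx'
  have hmain := h 0 1 0 ((1 + ν ^ 2) / 2) ν label_pos (abs_le_label hν0) G
  refine absurd (hmain ?_ ?_ ?_ ?_ ?_ ?_ ?_) ?_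
  · -- H1: smoothness
    intro x hx
    exact (hsmooth x (hBpos x ((hExt x).1 hx))).contDiffWithinAt
  · -- H2: Lorentzian, symmetric, invertible
    intro x hx
    have hr := hBpos x ((hExt x).1 hx)
    exact ⟨isInvertible_squeezed hB hB' hG hν hr, fun v w ↦ by rw [hG, hG, Kerr.bilin_symm],
      squeezed_signature hB hB' hG hν hM₁0 hr⟩
  · -- H3: Ricci-flat
    intro x hx
    exact ricAt_squeezed hB hB' hG hν (hBpos x ((hExt x).1 hx))
  · -- H4: `C⁰` anchor
    intro x hx
    rw [boostedKerrBilin_one_zero]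
    exact squeezed_anchor hB hG hC0 hC₁ hνlo hν1 ((hExt x).1 hx)
  · -- H5: tame bounds, every order, every `R'`
    intro j R'
    obtain ⟨C, hC⟩ := squeezed_tame hB hν0 hν1.le L M₁ j
    exact ⟨C, fun x hx _ ↦ hC x ((hExt x).1 hx)⟩
  · -- H6: stationarity
    intro x _ t
    rw [h1e]
    ext v w
    rw [hG, hG, squeeze_add_smul_basisVector_zero hB, Kerr.bilin_add_smul_basisVector_zero]
  · -- H7: null inner boundary
    intro ε' hε'
    obtain ⟨δ, hδ, hδ'⟩ := squeezed_null_boundary hB hB' hG hν0 hν1 hGc hε'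
    refine ⟨δ, hδ, fun x hx hlt ↦ ?_⟩
    rw [poincareInv_one_zero, rPlus_label hν0 hν1] at hlt
    rw [hfun]
    exact hδ' x ((hExt x).1 hx) hlt
  · -- the conclusion fails: no gauge onto the squeezed form
    clear hmain
    rintro ⟨M', a', Λ', c', θ, κ, hM', -, -, hΛ', hθ, -, himage, hcomm, -, -, hiso⟩
    clear h
    rw [h1e] at hΛ' hcomm
    exact squeezed_no_gauge hB hG hν0 hν1 hM' hΛ' (hθ.differentiableOn (by simp)) hcomm himage
      fun x hx v w ↦ (hiso x hx v w).1

end Summit.FinalStateConjecture.FinalStateConjecture.Theorems.ClusterCompleteness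

end
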